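import Literature.NumberTheory.Automorphic.ResGLnCuspidalCohomologyApexInvariants
import Literature.NumberTheory.Automorphic.ResGLnCuspidalCohomologyApexDegreeZero
import HarnessLib

/-!
# Clozel's Lemme 3.14/3.15 for `Res_{K/ℚ} GLₙ`: the apex fact reduced to the existence of
# `(𝔤, K_∞)`-cohomology for unitary `(𝔤, K_∞)`-modules with the infinitesimal character of `E_λ^∨`

Topic `NumberTheory/Automorphic`; namespace `Literature.NumberTheory.Automorphic.ConeDictionary`
(vocabulary of `ResGLnCuspidalCohomologyApex{Module,Submodule,Invariants,DegreeZero}`).  One theorem;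
no definition, no named fact, no `sorry`.

After the Kuga line (`ResGLnCuspidalCohomologyApex{Kuga,Scalars,Assembly,Submodule}`: the apex fact
`Clozel1990_exists_basic_levelFixed_cocycle` follows from a non-zero basic cochain of positive degree of
`C^•(𝔤, K_∞; V ⊗ (E_λ ⊗ ε_S))` for a `(𝔤, K_∞)`-module `V` injecting into `e_{K(𝔫)} W`), the module
`V = W^{K(𝔫)}` is made an honest object of the archimedean theory
(`ResGLnCuspidalCohomologyApexInvariants`: `(𝔤, K_∞)`-module axioms, admissibility, the Petersson
form, the archimedean parameter of `π`) and the degree bookkeeping is done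
(`ResGLnCuspidalCohomologyApexDegreeZero`: `H⁰ = 0` for modules embedded in the cusp forms, so a
non-zero class gives a non-zero basic cochain of positive degree).  Hence
**`Clozel1990_exists_basic_levelFixed_cocycle_of_unitary_gkCohomology`**: the apex fact holds as
soon as every non-zero admissible, essentially unitary `(𝔤, K_∞)`-module of `GL_n(K_∞)` (`n ≥ 2`)
with the archimedean parameter of `E_λ^∨` (`λ` dominant) has `H^q(𝔤, K_∞; V ⊗ (E_λ(ℂ) ⊗ ε_S)) ≠ 0`
for some set `S` of real places and some `q` — a statement of the representation theory of the real
groups `GL_n(ℝ)`, `GL_n(ℂ)` alone (no automorphy, no level): for irreducible `V` it is the existence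
half of the Vogan–Zuckerman classification of the unitary modules with cohomology
[cite: VoganZuckerman1984, Thm. 5.5 (p. 74), Thm. 5.6 (p. 75)] completed by Salamanca-Riba
(unitary with strongly regular integral infinitesimal character `⇒ A_𝔮(λ)`)
[cite: SalamancaRiba1999, main theorem] [cite: Huang2015DiracElliptic, Thm. 39], with
Borel–Wallach I §5.1 (components of `K_∞`, the sign characters `ε_S`) and I §1.3 (the split centre)
[cite: BorelWallach2000, VI Thm. 5.3–5.4, I §5.1, §1.3]; for the generic `π_v` of a cuspidal
regular algebraic `π` it is Clozel's Lemme 3.14 [cite: Clozel1990, Lemme 3.14 (p. 114)] (Speh for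
`GL_n(ℝ)`, Enright for `GL_n(ℂ)`); an admissible essentially unitary module being completely reducible
with finitely many isotypic summands, the irreducible case suffices.  That statement is NOT in the
tree (it needs the unitary dual / cohomological induction for `GL_n(ℝ)`, `GL_n(ℂ)`); it is the
hypothesis `H` below, the exact residual of the apex fact.

## References

* L. Clozel, *Motifs et formes automorphes* (1990), Lemme 3.14 (p. 114), Lemme 3.15 (p. 121), §3.5.
  [Clozel1990]
* D. A. Vogan, G. J. Zuckerman, *Unitary representations with non-zero cohomology*, Compositio
  Math. 53 (1984), Thm. 5.5–5.6. [VoganZuckerman1984]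
* S. A. Salamanca-Riba, *On the unitary dual of real reductive Lie groups and the `A_𝔮(λ)` modules:
  the strongly regular case*, Duke Math. J. 96 (1999). [SalamancaRiba1999]
* J.-S. Huang, *Dirac cohomology, elliptic representations and endoscopy* (2015), Thm. 39.
  [Huang2015DiracElliptic]
* A. Borel, N. Wallach (2000), I §1.3, §5.1, II Prop. 3.1, VI 5.3–5.4 (held). [BorelWallach2000]
-/

noncomputable section

-- Mathlib idiom (Mathlib/Algebra/Lie/OfAssociative.lean), as in `GKModules`: the commutator bracket on
-- `Module.End ℂ V`, needed to speak of `𝔤 →ₗ⁅ℝ⁆ Module.End ℂ V` in the hypothesis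
attribute [local instance 100] LieRing.ofAssociativeRing

open scoped TensorProduct Classical _root_.Matrix
open _root_.NumberField _root_.NumberField.InfinitePlace _root_.NumberField.mixedEmbedding IsDedekindDomain

namespace Literature.NumberTheory.Automorphic

namespace ConeDictionary

open ResGLnCohomology RealMatrixGroup Literature.Algebra.Lie.ChevalleyEilenberg
  Literature.NumberTheory.DiophantineGeometry Literature.Barriers.Langlands

set_option maxHeartbeats 800000 in
-- the towers over the datum are deep (as in the sibling `Apex` files)
/-- **Clozel's Lemme 3.14/3.15 (the apex fact) reduced to the archimedean theory of unitary
`(𝔤, K_∞)`-modules.**  The apex fact `Clozel1990_exists_basic_levelFixed_cocycle` holds as soon as: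
for every `n ≥ 2`, number field `K`, dominant `λ` and every NON-ZERO ADMISSIBLE `(𝔤, K_∞)`-module
`(V, ρK, ρ𝔤)` of `GL_n(K_∞)` carrying a positive definite Hermitian form for which the `X ∈ 𝔤` of norm
exponent zero act skew-adjointly (unitarity up to a real power of `|det|_∞`) and having the
archimedean parameter `σ ↦ {λ^∨_{σ,i} + ρ_i}` of `E_λ^∨`, some `H^q(𝔤, K_∞; V ⊗ (E_λ(ℂ) ⊗ ε_S))` is
non-zero — the existence half of the Vogan–Zuckerman classification (Salamanca-Riba; for the
generic `π_v` of cuspidal `π` Clozel's Lemme 3.14, for `GL_n(ℝ)`, `GL_n(ℂ)` Speh, Enright), through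
the complete reducibility of admissible unitary modules.  Proof: apply the hypothesis to
`V = W^{K(𝔫)}` (`ResGLnCuspidalCohomologyApexInvariants`: a `(𝔤, K_∞)`-module, admissible, essentially
unitary by the Petersson form, with the archimedean parameter of `π`, non-zero by the `K(𝔫)`-fixed
form), turn the class into a non-zero basic cochain of positive degree
(`exists_nonzero_basic_of_nontrivial_cohomology`: `H⁰ = 0` for modules embedded in the cusp forms)
and conclude by `Clozel1990_exists_basic_levelFixed_cocycle_of_nonzero_moduleCochain`.
[cite: Clozel1990, Lemme 3.14 (p. 114), Lemme 3.15 (p. 121), §3.5 (p. 123)]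
[cite: VoganZuckerman1984, Thm. 5.5, Thm. 5.6] [cite: BorelWallach2000, VI Thm. 5.3, I §5.1, II Prop. 3.1] -/
theorem Clozel1990_exists_basic_levelFixed_cocycle_of_unitary_gkCohomology
    (H : ∀ (n : ℕ) (K : Type) [Field K] [NumberField K] (hcpt : isCompact_glFiniteIntegralLevel n K)
      (lam : (K →+* ℂ) → Fin n → ℤ), 2 ≤ n → (∀ τ, Weight.IsDominant (lam τ)) →
      ∀ (V : Type) [AddCommGroup V] [Module ℂ V]
        (ρK : Representation ℂ (AutomorphyDatum.gl n K hcpt).arch.maximalCompact V)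
        (ρ𝔤 : (AutomorphyDatum.gl n K hcpt).arch.lie →ₗ⁅ℝ⁆ Module.End ℂ V)
        (hV : IsGKModule (AutomorphyDatum.gl n K hcpt).arch ρK ρ𝔤),
        Nontrivial V → IsAdmissibleGK ρK →
        (∃ ip : V → V → ℂ, Kuga.IsPosForm ip ∧
          ∀ X : (AutomorphyDatum.gl n K hcpt).arch.lie,
            ((∑ w, (X : Matrix (Fin n) (Fin n) (mixedSpace K)).trace.1 w) +
                ∑ w, 2 * ((X : Matrix (Fin n) (Fin n) (mixedSpace K)).trace.2 w).re) = 0 →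
            ∀ v w : V, ip (ρ𝔤 X v) w = -ip v (ρ𝔤 X w)) →
        Automorphic.HasArchParameter
          (ρ𝔤.comp (LieSubalgebra.topEquiv :
            (⊤ : LieSubalgebra ℝ (Matrix (Fin n) (Fin n) (mixedSpace K))) ≃ₗ⁅ℝ⁆
              Matrix (Fin n) (Fin n) (mixedSpace K)).symm.toLieHom)
          (fun σ ↦ (cohomologicalInfinityType n K (Weight.dual (lam σ)) σ).map ArchWeight.a) →
        ∃ (S : Finset {w : InfinitePlace K // w.IsReal}) (q : ℕ),
          Nontrivial ((gkComplexV ρK ρ𝔤 hV.ad_compat S lam).Cohomology q)) :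
    Clozel1990_exists_basic_levelFixed_cocycle := by
  refine Clozel1990_exists_basic_levelFixed_cocycle_of_nonzero_moduleCochain ?_
  intro n K _ _ hcpt 𝔫 lam hn h𝔫 hdom π hW' hμ hT hφ
  haveI : NeZero n := ⟨by omega⟩
  -- the module `V = W^{K(𝔫)}`
  have hGK := isGKModule_invW π.1 h𝔫 hW'
  have hadm := isAdmissibleGK_invKRep π.1 h𝔫 hW'
  have hform := exists_isPosForm_invW π.1 h𝔫 π.2 hW'
  obtain ⟨T, hT1, hTa⟩ := hT
  have hpar : π.1.HasArchParameter fun σ => (cohomologicalInfinityType n K (Weight.dual (lam σ)) σ).map ArchWeight.a := by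
    have hfun : (fun σ => (T σ).map ArchWeight.a) =
        fun σ => (cohomologicalInfinityType n K (Weight.dual (lam σ)) σ).map ArchWeight.a := funext hTa
    have h2 := hT1.2
    rw [hfun] at h2
    exact h2
  have hparV := hasArchParameter_invLie π.1 h𝔫 hW' hpar
  -- `W^{K(𝔫)} ≠ 0`: the non-zero `K(𝔫)`-fixed form
  obtain ⟨φ, hφW, hφ0, hφfix⟩ := hφ
  have hmem : (⟨φ, hφW⟩ : π.1.W) ∈ invW π.1 h𝔫 := by
    refine (mem_invW_iff π.1 h𝔫 _).2 (levelProj_eq_self π.1 h𝔫 fun u hu => Subtype.ext ?_)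
    rw [AutomorphicRepData.coe_finiteRepW_apply]
    exact hφfix _ ((mem_levelFin_iff u).1 hu)
  haveI : Nontrivial (invW π.1 h𝔫) := by
    refine ⟨⟨⟨_, hmem⟩, 0, fun h => hφ0 ?_⟩⟩
    have h' := congrArg (fun x : invW π.1 h𝔫 => ((x : π.1.W) : (AdelicGroupData.gl n K).Adelic → ℂ)) h
    exact h'
  -- the archimedean input
  have hH := H n K hcpt lam hn hdom (invW π.1 h𝔫) (invKRep π.1 h𝔫) (invLie π.1 h𝔫) hGK inferInstance hadm hform hparV
  obtain ⟨S, q, hcoh⟩ := hH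
  -- `Z` acts on `W^{K(𝔫)}` by a scalar
  obtain ⟨μ, hμ'⟩ := hμ
  have ha : ∀ v : invW π.1 h𝔫, invLie π.1 h𝔫 (centerOne n K hcpt) v = μ • v := invLie_centerOne π.1 h𝔫 hμ'
  -- a non-zero basic cochain of positive degree
  have hb := exists_nonzero_basic_of_nontrivial_cohomology (inv_ad_compat π.1 h𝔫) S lam hn π hW'
    (j := (invW π.1 h𝔫).subtype) (fun X => subtype_comp_invLie π.1 h𝔫 X) (invW π.1 h𝔫).injective_subtype ha hcoh
  obtain ⟨q', z, hz, hins, hne⟩ := hb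
  refine ⟨S, invW π.1 h𝔫, inferInstance, inferInstance, invKRep π.1 h𝔫, invLie π.1 h𝔫, inv_ad_compat π.1 h𝔫,
    (invW π.1 h𝔫).subtype, subtype_comp_invKRep π.1 h𝔫, subtype_comp_invLie π.1 h𝔫, (invW π.1 h𝔫).injective_subtype,
    levelProj_coe_invW π.1 h𝔫, q', z, hz, ?_, hne⟩
  exact hins

end ConeDictionary

end Literature.NumberTheory.Automorphic

end
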